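import Literature.AlgebraicGeometry.HodgeTheory.PicardLefschetzNodalFormsKeyed
import Literature.AlgebraicGeometry.HodgeTheory.PicardLefschetzNodalFormsFlatShapes
import Literature.AlgebraicGeometry.HodgeTheory.UniversalHypersurfaceFlatCoefficient
import HarnessLib

/-!
# The keyed Picard–Lefschetz binders: implications from the uniform facts, and data at any radius (theorems only)

Family `hodge`, layer `Literature/AlgebraicGeometry/HodgeTheory`; companion of `PicardLefschetzNodalFormsKeyed` (definitions
`picardLefschetz_oneNode`, `picardLefschetz_exchangedPair`).  Written by the prover seat `hodge-nonav-19716-p2` (g10, cell `hodge-nonav`) for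
crux K1-B `VeryGeneralSignCommutatorsInHg` (route `HodgeConjecture/SignSymmetricPowers`, stmt-HodgeConjecture-19716), P3 g34 DECISION
22:46:09Z.  Theorems only (no definition, no named fact, no `sorry`):

* `picardLefschetz_oneNode_of_flat`, `picardLefschetz_exchangedPair_of_flatExchange` (and `…_of_uniform`) — the graded series:
  the uniform facts imply the keyed instances (lineage of the registries v18–v22 of K1-B);
* `picardLefschetz_oneNode.exists_isPicardLefschetzData_of_radius`, `picardLefschetz_exchangedPair.exists_isPicardLefschetzData_of_radius`
  — for ODD fibre dimension `n` (no rider), Picard–Lefschetz data on a circle of ANY radius inside the punctured disc of nonsingular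
  members, with SOME coefficient: data at an infinitesimal radius from the fact, moved outward by `IsPicardLefschetzData.exists_of_concentric`
  along the PROVED flat coefficient of `UniversalHypersurfaceFlatCoefficient` (prover seat `hodge-nonav-prover-Bx`), rescaled by
  `IsFlatCoefficient.const_mul` to take the value of the datum's own coefficient at the inner point.

Nothing here says HC is proved.

## References

* [VoisinHodgeII2003] C. Voisin, Hodge Theory and Complex Algebraic Geometry II, CUP 2003: §2.3.1, §3.1.2, §3.2.1 Thm. 3.16, §3.2.2, §3.2.3.
* [Hatcher2002] A. Hatcher, Algebraic Topology, §1.1 Lemma 1.19.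
* [Deligne1974] P. Deligne, La conjecture de Weil. I, (5.3).
-/

noncomputable section

open CategoryTheory AlgebraicGeometry MvPolynomial
open Literature.AlgebraicTopology.SingularHomology
open Literature.AlgebraicGeometry.Motives Literature.AlgebraicGeometry.Motives.UniversalHypersurface

namespace Literature.AlgebraicGeometry.HodgeTheory

section HodgeTheory

variable {n d : ℕ}

/-! ### §1 The uniform facts imply the keyed instances -/

/-- `g(![p] i) ≠ 0` from `g(p) ≠ 0`. [folklore] -/
private theorem eval_vecOne_ne {n : ℕ} {g : MvPolynomial (Fin (n + 2)) ℂ} {p : Fin (n + 2) → ℂ} (hgp : eval p g ≠ 0) :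
    ∀ i : Fin 1, eval ((![p] : Fin 1 → Fin (n + 2) → ℂ) i) g ≠ 0 := by
  intro i
  fin_cases i
  exact hgp

/-- The flat package implies the one-node instance: take the flat coefficient's value `c(s')`; the radius `ε₀` is extracted for the
canonical trivialisation datum and serves every `hU` by proof irrelevance; the rider is not needed. [cite: VoisinHodgeII2003, §3.2.1 Thm. 3.16] -/
theorem picardLefschetz_oneNode_of_flat (H : picardLefschetz_nodalForms_flat) : picardLefschetz_oneNode := by
  intro n d hn hd f₁ g hf hg p hp hgp
  obtain ⟨c, -, hc⟩ := H n d hn hd (UniversalHypersurface.isCohomologicallyLocallyTrivialOn_family n d hd)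
  obtain ⟨ε₀, hε₀, hsm, hrest⟩ := hc 1 f₁ g hf hg ![p] hp (eval_vecOne_ne hgp)
  refine ⟨ε₀, hε₀, hsm, fun hU ε h0 h1 s' hs' γ hγ _ ↦ ?_⟩
  obtain ⟨δ, hPL⟩ := hrest ε h0 h1 s' hs' γ hγ
  refine ⟨δ 0, c s', ?_⟩
  have e : (![δ 0] : Fin 1 → bettiCohomology (fiberOver (family ℂ n d) s') n) = δ := by
    funext i; fin_cases i; rfl
  rw [e]
  exact hPL

/-- The flat package with the exchange rule implies the exchanged-pair instance (the exchange clause for the given symmetry is the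
instance `i = 1, j = 0` of `IsExchangePicardLefschetzData`). [cite: VoisinHodgeII2003, §3.2.1 Thm. 3.16 and §2.2.1 Def. 2.12] -/
theorem picardLefschetz_exchangedPair_of_flatExchange (H : picardLefschetz_nodalForms_flatExchange) :
    picardLefschetz_exchangedPair := by
  intro n d hn hd f₁ g hf hg p hp hgp a ha h₁ h₂ hswap
  obtain ⟨c, -, hc⟩ := H n d hn hd (UniversalHypersurface.isCohomologicallyLocallyTrivialOn_family n d hd)
  obtain ⟨ε₀, hε₀, hsm, hrest⟩ := hc 2 f₁ g hf hg p hp hgp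
  refine ⟨ε₀, hε₀, hsm, fun hU ε h0 h1 s' hs' γ hγ _ ↦ ?_⟩
  obtain ⟨δ, hPL, hEx⟩ := hrest ε h0 h1 s' hs' γ hγ
  exact ⟨δ, c s', hPL, fun σ' hσ' => hEx a ha h₁ h₂ σ' hσ' 1 0 (by decide) hswap⟩

/-- The uniform fact implies the one-node instance. [cite: VoisinHodgeII2003, §3.2.1 Thm. 3.16] -/
theorem picardLefschetz_oneNode_of_uniform (H : picardLefschetz_nodalForms_uniform) : picardLefschetz_oneNode :=
  picardLefschetz_oneNode_of_flat (picardLefschetz_nodalForms_flat_of_uniform H)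

/-- The uniform fact implies the exchanged-pair instance. [cite: VoisinHodgeII2003, §3.2.1 Thm. 3.16] -/
theorem picardLefschetz_exchangedPair_of_uniform (H : picardLefschetz_nodalForms_uniform) : picardLefschetz_exchangedPair :=
  picardLefschetz_exchangedPair_of_flatExchange (picardLefschetz_nodalForms_flatExchange_of_uniform H)

/-! ### §2 Data at any radius (odd fibre dimension), with some coefficient -/

/-- **One-node Picard–Lefschetz data on a circle of ANY radius inside the punctured disc of nonsingular members** (odd `n`, so the
rider is void): from `picardLefschetz_oneNode`, data at an infinitesimal radius with its own coefficient `c₁`; the proved flat coefficient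
`cf` (`exists_isFlatCoefficient`) rescaled to `(c₁ / cf(s₁)) · cf` takes the value `c₁` at the inner point, and
`IsPicardLefschetzData.exists_of_concentric` moves the data to radius `r`.
[cite: VoisinHodgeII2003, §3.2.1 Thm. 3.16, §3.2.2, §3.1.2 and §2.3.1] [cite: Hatcher2002, §1.1 Lemma 1.19 (p. 37)] -/
theorem picardLefschetz_oneNode.exists_isPicardLefschetzData_of_radius (H : picardLefschetz_oneNode) (hn : 1 ≤ n) (hd : 1 ≤ d)
    (hodd : Odd n) (hU : IsCohomologicallyLocallyTrivialOn (family ℂ n d) Set.univ) {f₁ g : MvPolynomial (Fin (n + 2)) ℂ}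
    (hf₁ : f₁.IsHomogeneous d) (hg : g.IsHomogeneous d) {p : Fin (n + 2) → ℂ} (hp : IsNodalFormWithNodes f₁ ![p])
    (hgp : eval p g ≠ 0) {r : ℝ} (hr : 0 < r)
    (hJr : ∀ c' : ℂ, c' ≠ 0 → ‖c'‖ ≤ r → SmoothHypersurface.IsNonsingularForm ℂ (f₁ + c' • g))
    {s : ComplexPoints (base ℂ n d)} (hs : pointForm ℂ n d s = f₁ + (r : ℂ) • g) {γ : Path s s}
    (hγ : IsPencilCircle n d f₁ g r γ) :
    ∃ (δ : bettiCohomology (fiberOver (family ℂ n d) s) n) (c : ℚ), IsPicardLefschetzData n d 1 hn hd hU γ ![δ] c := by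
  obtain ⟨ε₀, hε₀, -, hrest⟩ := H n d hn hd f₁ g hf₁ hg p hp hgp
  -- an infinitesimal radius `ε` inside `(0, r]`
  obtain ⟨ε, hε0, hε1, hεr⟩ : ∃ ε : ℝ, 0 < ε ∧ ε < ε₀ ∧ ε ≤ r :=
    ⟨min (ε₀ / 2) r, lt_min (half_pos hε₀) hr, lt_of_le_of_lt (min_le_left _ _) (half_lt_self hε₀),
      min_le_right _ _⟩
  have hJεr : ∀ c' : ℂ, ‖c'‖ ∈ Set.uIcc r ε → SmoothHypersurface.IsNonsingularForm ℂ (f₁ + c' • g) := by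
    intro c' hc'
    rw [Set.uIcc_of_ge hεr] at hc'
    have hne : c' ≠ 0 := fun h0 => by
      rw [h0, norm_zero] at hc'
      exact absurd hc'.1 (not_le.2 hε0)
    exact hJr c' hne hc'.2
  have hJε : ∀ c' : ℂ, ‖c'‖ = |ε| → SmoothHypersurface.IsNonsingularForm ℂ (f₁ + c' • g) := fun c' hc' =>
    hJεr c' (by rw [hc', abs_of_pos hε0, Set.uIcc_of_ge hεr]; exact ⟨le_rfl, hεr⟩)
  obtain ⟨s₁, hs₁⟩ := exists_point_of_isNonsingularForm ℂ n d (isHomogeneous_add_smul hf₁ hg (ε : ℂ))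
    (hJε _ (by rw [Complex.norm_real, Real.norm_eq_abs]))
  obtain ⟨γ₁, hγ₁⟩ := exists_isPencilCircle hf₁ hg hJε s₁ hs₁
  -- Picard–Lefschetz data at radius `ε` (the rider is void for odd `n`)
  obtain ⟨δ₁, c₁, hPL₁⟩ := hrest hU ε hε0 hε1 s₁ hs₁ γ₁ hγ₁ fun he => (Nat.not_even_iff_odd.2 hodd he).elim
  -- the flat coefficient rescaled to take the value `c₁` at `s₁`
  obtain ⟨cf, hcf⟩ := exists_isFlatCoefficient n d hn hd hU
  have hc₁ : c₁ ≠ 0 := hPL₁.c_ne_zero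
  have hκ : c₁ / cf s₁ ≠ 0 := div_ne_zero hc₁ (hcf.1 s₁)
  have hcf' := hcf.const_mul hκ
  have e₁ : c₁ / cf s₁ * cf s₁ = c₁ := div_mul_cancel₀ c₁ (hcf.1 s₁)
  have hPL₁' : IsPicardLefschetzData n d 1 hn hd hU γ₁ ![δ₁] (c₁ / cf s₁ * cf s₁) := by rw [e₁]; exact hPL₁
  obtain ⟨δ', h'⟩ := hPL₁'.exists_of_concentric hcf' hf₁ hg hr.le hε0.le hJεr hs hs₁ hγ hγ₁
  refine ⟨δ' 0, c₁ / cf s₁ * cf s, ?_⟩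
  have e : (![δ' 0] : Fin 1 → bettiCohomology (fiberOver (family ℂ n d) s) n) = δ' := by
    funext i; fin_cases i; rfl
  rw [e]
  exact h'

/-- **Exchanged-pair Picard–Lefschetz data on a circle of ANY radius inside the punctured disc of nonsingular members** (odd `n`; the
exchange clause is not transported — consumers at a distance only need the data): same proof from `picardLefschetz_exchangedPair`.
[cite: VoisinHodgeII2003, §3.2.1 Thm. 3.16, §3.2.2, §3.1.2 and §2.3.1] [cite: Hatcher2002, §1.1 Lemma 1.19 (p. 37)] -/
theorem picardLefschetz_exchangedPair.exists_isPicardLefschetzData_of_radius (H : picardLefschetz_exchangedPair) (hn : 1 ≤ n)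
    (hd : 1 ≤ d) (hodd : Odd n) (hU : IsCohomologicallyLocallyTrivialOn (family ℂ n d) Set.univ)
    {f₁ g : MvPolynomial (Fin (n + 2)) ℂ} (hf₁ : f₁.IsHomogeneous d) (hg : g.IsHomogeneous d) {p : Fin 2 → Fin (n + 2) → ℂ}
    (hp : IsNodalFormWithNodes f₁ p) (hgp : ∀ i, eval (p i) g ≠ 0) {a : Fin (n + 2) → ℂˣ} (ha : IsOfFinOrder a)
    (h₁ : a ∈ diagonalStabilizer f₁) (h₂ : a ∈ diagonalStabilizer g) (hswap : ∃ t : ℂ, a • p 1 = t • p 0) {r : ℝ} (hr : 0 < r)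
    (hJr : ∀ c' : ℂ, c' ≠ 0 → ‖c'‖ ≤ r → SmoothHypersurface.IsNonsingularForm ℂ (f₁ + c' • g))
    {s : ComplexPoints (base ℂ n d)} (hs : pointForm ℂ n d s = f₁ + (r : ℂ) • g) {γ : Path s s}
    (hγ : IsPencilCircle n d f₁ g r γ) :
    ∃ (δ : Fin 2 → bettiCohomology (fiberOver (family ℂ n d) s) n) (c : ℚ), IsPicardLefschetzData n d 2 hn hd hU γ δ c := by
  obtain ⟨ε₀, hε₀, -, hrest⟩ := H n d hn hd f₁ g hf₁ hg p hp hgp a ha h₁ h₂ hswap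
  obtain ⟨ε, hε0, hε1, hεr⟩ : ∃ ε : ℝ, 0 < ε ∧ ε < ε₀ ∧ ε ≤ r :=
    ⟨min (ε₀ / 2) r, lt_min (half_pos hε₀) hr, lt_of_le_of_lt (min_le_left _ _) (half_lt_self hε₀),
      min_le_right _ _⟩
  have hJεr : ∀ c' : ℂ, ‖c'‖ ∈ Set.uIcc r ε → SmoothHypersurface.IsNonsingularForm ℂ (f₁ + c' • g) := by
    intro c' hc'
    rw [Set.uIcc_of_ge hεr] at hc'
    have hne : c' ≠ 0 := fun h0 => by
      rw [h0, norm_zero] at hc'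
      exact absurd hc'.1 (not_le.2 hε0)
    exact hJr c' hne hc'.2
  have hJε : ∀ c' : ℂ, ‖c'‖ = |ε| → SmoothHypersurface.IsNonsingularForm ℂ (f₁ + c' • g) := fun c' hc' =>
    hJεr c' (by rw [hc', abs_of_pos hε0, Set.uIcc_of_ge hεr]; exact ⟨le_rfl, hεr⟩)
  obtain ⟨s₁, hs₁⟩ := exists_point_of_isNonsingularForm ℂ n d (isHomogeneous_add_smul hf₁ hg (ε : ℂ))
    (hJε _ (by rw [Complex.norm_real, Real.norm_eq_abs]))
  obtain ⟨γ₁, hγ₁⟩ := exists_isPencilCircle hf₁ hg hJε s₁ hs₁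
  obtain ⟨δ₁, c₁, hPL₁, -⟩ := hrest hU ε hε0 hε1 s₁ hs₁ γ₁ hγ₁ fun he => (Nat.not_even_iff_odd.2 hodd he).elim
  obtain ⟨cf, hcf⟩ := exists_isFlatCoefficient n d hn hd hU
  have hc₁ : c₁ ≠ 0 := hPL₁.c_ne_zero
  have hκ : c₁ / cf s₁ ≠ 0 := div_ne_zero hc₁ (hcf.1 s₁)
  have hcf' := hcf.const_mul hκ
  have e₁ : c₁ / cf s₁ * cf s₁ = c₁ := div_mul_cancel₀ c₁ (hcf.1 s₁)
  have hPL₁' : IsPicardLefschetzData n d 2 hn hd hU γ₁ δ₁ (c₁ / cf s₁ * cf s₁) := by rw [e₁]; exact hPL₁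
  obtain ⟨δ', h'⟩ := hPL₁'.exists_of_concentric hcf' hf₁ hg hr.le hε0.le hJεr hs hs₁ hγ hγ₁
  exact ⟨δ', c₁ / cf s₁ * cf s, h'⟩

end HodgeTheory

end Literature.AlgebraicGeometry.HodgeTheory

end
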